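import Summits.CriticalPhenomena.PercolationContinuityZ3.Theorems.PercNearOneGluingNoHeavyLowerTailSahiOneStepTwoLumpStep
import Summits.CriticalPhenomena.PercolationContinuityZ3.Theorems.PercNearOneGluingNoHeavyLowerTailSahiOneStepTwoLumpHull
import HarnessLib

/-!
# Two-sided lumping — `Ψ` under the upper hull, and the degenerate lower level

Support file (prover prim-ineq-prove-3 gen 50; `--supports stmt-CriticalPhenomena-4575`; memo
`run/shared/lean/prim/prim-ineq-prove-3/FINDING-G50-TWO-SIDED-LUMPING.md`, §2.2 (c)).  No definitions, no named facts, no sorries, no `native_decide`.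

`twoLump_genb_le`: the two-sided lumping functional `Ψ` (see `…TwoLumpStep`) does not increase when `B` is replaced by its hull generated below
`s` (`…TwoLumpHull`): with the traces below `s` fixed, `Ψ` is affine in `μ(T_s ∩ B)` with slope `(1−μT_t)(μ(T_s∩A) − μT_s·μA) ≥ 0` (Harris).
`twoLump_zero_left`: `Ψ = 0` when the lower level is `0`.
-/

noncomputable section

namespace Summit.CriticalPhenomena.PercolationContinuityZ3.Theorems

namespace SahiOneStep

open MeasureTheory Finset
open Literature.Probability.Percolation (DeterminedBy determinedBy_iff)
open Literature.Probability.LatticeModels (prodBernoulli prodBernoulli_harris)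
open Literature.Probability.Percolation.DecisionTree (ind)
open SahiE3Sections (determinedBy_section_insert determinedBy_section_sdiff)
open scoped Classical

variable {ι : Type*} [Fintype ι]

/-! ## `Ψ` does not increase under the upper hull (generation below `s`) of `B` -/

/-- The middle region splits `T_t ∩ Y`. [folklore] -/
theorem real_threshold_inter_eq_add (p : ι → unitInterval) (G : Finset ι) {t s : ℕ} (hts : t ≤ s) (Y : Set (Set ι)) :
    (prodBernoulli p).real ({ω : Set ι | t ≤ (G.filter (· ∈ ω)).card} ∩ Y) =
      (prodBernoulli p).real ({ω : Set ι | s ≤ (G.filter (· ∈ ω)).card} ∩ Y) + (prodBernoulli p).real (Y ∩ {ω : Set ι | t ≤ (G.filter (· ∈ ω)).card ∧ (G.filter (· ∈ ω)).card < s}) := by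
  have h := real_threshold_inter_inter_eq_add p G hts Set.univ Y
  simp only [Set.inter_univ, Set.univ_inter] at h
  exact h

/-- `μ(Y) = μ(T_s ∩ Y) + μ(T_sᶜ ∩ Y)`. [folklore] -/
theorem real_eq_threshold_inter_add (p : ι → unitInterval) (G : Finset ι) (s : ℕ) (Y : Set (Set ι)) :
    (prodBernoulli p).real Y =
      (prodBernoulli p).real ({ω : Set ι | s ≤ (G.filter (· ∈ ω)).card} ∩ Y) + (prodBernoulli p).real ({ω : Set ι | s ≤ (G.filter (· ∈ ω)).card}ᶜ ∩ Y) := by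
  have h := measureReal_inter_add_sdiff (μ := prodBernoulli p) (s := Y) (t := {ω : Set ι | s ≤ (G.filter (· ∈ ω)).card}) MeasurableSet.of_discrete
  rw [Set.sdiff_eq, Set.inter_comm Y, Set.inter_comm Y] at h
  exact h.symm

/-- **Generation of `B` below `s` does not increase `Ψ`** (memo TL2(c)): with the traces below `s` fixed, `Ψ` is affine in `μ(T_s ∩ B)` with slope
`(1−μT_t)·(μ(T_s ∩ A) − μT_s·μA) ≥ 0` (Harris), and the hull has the smaller upper part. [this work] -/
theorem twoLump_genb_le (p : ι → unitInterval) (G : Finset ι) {t s : ℕ} (hts : t ≤ s) {A B : Set (Set ι)}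
    (hA : IsUpperSet A) (hB : IsUpperSet B) :
    (1 - (prodBernoulli p).real {ω : Set ι | t ≤ (G.filter (· ∈ ω)).card}) *
            (prodBernoulli p).real {ω : Set ι | s ≤ (G.filter (· ∈ ω)).card} *
            ((prodBernoulli p).real ({ω : Set ι | t ≤ (G.filter (· ∈ ω)).card} ∩ A ∩ {ω : Set ι | ∃ z : Set ι, z ⊆ ω ∧ z ∈ B ∧ z ∈ {ω : Set ι | (G.filter (· ∈ ω)).card < s}})
              - (prodBernoulli p).real ({ω : Set ι | s ≤ (G.filter (· ∈ ω)).card} ∩ A ∩ {ω : Set ι | ∃ z : Set ι, z ⊆ ω ∧ z ∈ B ∧ z ∈ {ω : Set ι | (G.filter (· ∈ ω)).card < s}}))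
        + (prodBernoulli p).real {ω : Set ι | s ≤ (G.filter (· ∈ ω)).card} *
            ((prodBernoulli p).real A - (prodBernoulli p).real ({ω : Set ι | t ≤ (G.filter (· ∈ ω)).card} ∩ A)) *
            ((prodBernoulli p).real {ω : Set ι | ∃ z : Set ι, z ⊆ ω ∧ z ∈ B ∧ z ∈ {ω : Set ι | (G.filter (· ∈ ω)).card < s}} - (prodBernoulli p).real ({ω : Set ι | t ≤ (G.filter (· ∈ ω)).card} ∩ {ω : Set ι | ∃ z : Set ι, z ⊆ ω ∧ z ∈ B ∧ z ∈ {ω : Set ι | (G.filter (· ∈ ω)).card < s}}))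
        + (1 - (prodBernoulli p).real {ω : Set ι | t ≤ (G.filter (· ∈ ω)).card}) *
            (prodBernoulli p).real ({ω : Set ι | s ≤ (G.filter (· ∈ ω)).card} ∩ A) *
            (prodBernoulli p).real ({ω : Set ι | s ≤ (G.filter (· ∈ ω)).card} ∩ {ω : Set ι | ∃ z : Set ι, z ⊆ ω ∧ z ∈ B ∧ z ∈ {ω : Set ι | (G.filter (· ∈ ω)).card < s}})
        - (1 - (prodBernoulli p).real {ω : Set ι | t ≤ (G.filter (· ∈ ω)).card}) *
            (prodBernoulli p).real {ω : Set ι | s ≤ (G.filter (· ∈ ω)).card} *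
            (prodBernoulli p).real A * (prodBernoulli p).real {ω : Set ι | ∃ z : Set ι, z ⊆ ω ∧ z ∈ B ∧ z ∈ {ω : Set ι | (G.filter (· ∈ ω)).card < s}}
    ≤ (1 - (prodBernoulli p).real {ω : Set ι | t ≤ (G.filter (· ∈ ω)).card}) *
            (prodBernoulli p).real {ω : Set ι | s ≤ (G.filter (· ∈ ω)).card} *
            ((prodBernoulli p).real ({ω : Set ι | t ≤ (G.filter (· ∈ ω)).card} ∩ A ∩ B)
              - (prodBernoulli p).real ({ω : Set ι | s ≤ (G.filter (· ∈ ω)).card} ∩ A ∩ B))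
        + (prodBernoulli p).real {ω : Set ι | s ≤ (G.filter (· ∈ ω)).card} *
            ((prodBernoulli p).real A - (prodBernoulli p).real ({ω : Set ι | t ≤ (G.filter (· ∈ ω)).card} ∩ A)) *
            ((prodBernoulli p).real B - (prodBernoulli p).real ({ω : Set ι | t ≤ (G.filter (· ∈ ω)).card} ∩ B))
        + (1 - (prodBernoulli p).real {ω : Set ι | t ≤ (G.filter (· ∈ ω)).card}) *
            (prodBernoulli p).real ({ω : Set ι | s ≤ (G.filter (· ∈ ω)).card} ∩ A) *
            (prodBernoulli p).real ({ω : Set ι | s ≤ (G.filter (· ∈ ω)).card} ∩ B)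
        - (1 - (prodBernoulli p).real {ω : Set ι | t ≤ (G.filter (· ∈ ω)).card}) *
            (prodBernoulli p).real {ω : Set ι | s ≤ (G.filter (· ∈ ω)).card} *
            (prodBernoulli p).real A * (prodBernoulli p).real B := by
  have hTs : IsUpperSet {ω : Set ι | s ≤ (G.filter (· ∈ ω)).card} := isUpperSet_threshold G s
  have hcD : {ω : Set ι | s ≤ (G.filter (· ∈ ω)).card}ᶜ ⊆ {ω : Set ι | (G.filter (· ∈ ω)).card < s} := fun ω h => by
    simp only [Set.mem_compl_iff, Set.mem_setOf_eq, not_le] at h ⊢; exact h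
  have hMD : {ω : Set ι | t ≤ (G.filter (· ∈ ω)).card ∧ (G.filter (· ∈ ω)).card < s} ⊆ {ω : Set ι | (G.filter (· ∈ ω)).card < s} := fun ω h => h.2
  -- traces below `s`
  have e1 : {ω : Set ι | s ≤ (G.filter (· ∈ ω)).card}ᶜ ∩ {ω : Set ι | ∃ z : Set ι, z ⊆ ω ∧ z ∈ B ∧ z ∈ {ω : Set ι | (G.filter (· ∈ ω)).card < s}} = {ω : Set ι | s ≤ (G.filter (· ∈ ω)).card}ᶜ ∩ B := inter_genb_eq_of_subset hB hcD
  have e2 : {ω : Set ι | t ≤ (G.filter (· ∈ ω)).card ∧ (G.filter (· ∈ ω)).card < s} ∩ {ω : Set ι | ∃ z : Set ι, z ⊆ ω ∧ z ∈ B ∧ z ∈ {ω : Set ι | (G.filter (· ∈ ω)).card < s}} = {ω : Set ι | t ≤ (G.filter (· ∈ ω)).card ∧ (G.filter (· ∈ ω)).card < s} ∩ B := inter_genb_eq_of_subset hB hMD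
  have e3 : {ω : Set ι | ∃ z : Set ι, z ⊆ ω ∧ z ∈ B ∧ z ∈ {ω : Set ι | (G.filter (· ∈ ω)).card < s}} ∩ {ω : Set ι | t ≤ (G.filter (· ∈ ω)).card ∧ (G.filter (· ∈ ω)).card < s} = B ∩ {ω : Set ι | t ≤ (G.filter (· ∈ ω)).card ∧ (G.filter (· ∈ ω)).card < s} := by rw [Set.inter_comm, e2, Set.inter_comm]
  have e4 : A ∩ {ω : Set ι | ∃ z : Set ι, z ⊆ ω ∧ z ∈ B ∧ z ∈ {ω : Set ι | (G.filter (· ∈ ω)).card < s}} ∩ {ω : Set ι | t ≤ (G.filter (· ∈ ω)).card ∧ (G.filter (· ∈ ω)).card < s} = A ∩ B ∩ {ω : Set ι | t ≤ (G.filter (· ∈ ω)).card ∧ (G.filter (· ∈ ω)).card < s} := by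
    rw [Set.inter_assoc, e3, ← Set.inter_assoc]
  -- rewrite `Ψ` through the atoms
  rw [real_threshold_inter_inter_eq_add p G hts A {ω : Set ι | ∃ z : Set ι, z ⊆ ω ∧ z ∈ B ∧ z ∈ {ω : Set ι | (G.filter (· ∈ ω)).card < s}}, real_threshold_inter_inter_eq_add p G hts A B,
    real_threshold_inter_eq_add p G hts {ω : Set ι | ∃ z : Set ι, z ⊆ ω ∧ z ∈ B ∧ z ∈ {ω : Set ι | (G.filter (· ∈ ω)).card < s}}, real_threshold_inter_eq_add p G hts B,
    real_eq_threshold_inter_add p G s {ω : Set ι | ∃ z : Set ι, z ⊆ ω ∧ z ∈ B ∧ z ∈ {ω : Set ι | (G.filter (· ∈ ω)).card < s}}, real_eq_threshold_inter_add p G s B, e1, e3, e4]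
  have hmono : (prodBernoulli p).real ({ω : Set ι | s ≤ (G.filter (· ∈ ω)).card} ∩ {ω : Set ι | ∃ z : Set ι, z ⊆ ω ∧ z ∈ B ∧ z ∈ {ω : Set ι | (G.filter (· ∈ ω)).card < s}}) ≤ (prodBernoulli p).real ({ω : Set ι | s ≤ (G.filter (· ∈ ω)).card} ∩ B) :=
    measureReal_mono (Set.inter_subset_inter_right _ (genb_subset hB _))
  have hmonoA : (prodBernoulli p).real ({ω : Set ι | s ≤ (G.filter (· ∈ ω)).card} ∩ A ∩ {ω : Set ι | ∃ z : Set ι, z ⊆ ω ∧ z ∈ B ∧ z ∈ {ω : Set ι | (G.filter (· ∈ ω)).card < s}}) ≤ (prodBernoulli p).real ({ω : Set ι | s ≤ (G.filter (· ∈ ω)).card} ∩ A ∩ B) :=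
    measureReal_mono (Set.inter_subset_inter_right _ (genb_subset hB _))
  have hHarris : (prodBernoulli p).real {ω : Set ι | s ≤ (G.filter (· ∈ ω)).card} * (prodBernoulli p).real A ≤ (prodBernoulli p).real ({ω : Set ι | s ≤ (G.filter (· ∈ ω)).card} ∩ A) :=
    prodBernoulli_harris p hTs hA MeasurableSet.of_discrete MeasurableSet.of_discrete
  have hT1 : 0 ≤ 1 - (prodBernoulli p).real {ω : Set ι | t ≤ (G.filter (· ∈ ω)).card} := sub_nonneg.2 measureReal_le_one
  have h3 : 0 ≤ (1 - (prodBernoulli p).real {ω : Set ι | t ≤ (G.filter (· ∈ ω)).card}) *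
      ((prodBernoulli p).real ({ω : Set ι | s ≤ (G.filter (· ∈ ω)).card} ∩ B) - (prodBernoulli p).real ({ω : Set ι | s ≤ (G.filter (· ∈ ω)).card} ∩ {ω : Set ι | ∃ z : Set ι, z ⊆ ω ∧ z ∈ B ∧ z ∈ {ω : Set ι | (G.filter (· ∈ ω)).card < s}})) *
      ((prodBernoulli p).real ({ω : Set ι | s ≤ (G.filter (· ∈ ω)).card} ∩ A) - (prodBernoulli p).real {ω : Set ι | s ≤ (G.filter (· ∈ ω)).card} * (prodBernoulli p).real A) :=
    mul_nonneg (mul_nonneg hT1 (sub_nonneg.2 hmono)) (sub_nonneg.2 hHarris)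
  nlinarith [h3, hmonoA]



omit [Fintype ι] in
/-- `Ψ` vanishes when the lower level is `0` (no lower ball). [this work] -/
theorem twoLump_zero_left (p : ι → unitInterval) (F : Finset ι) (s : ℕ) (A B : Set (Set ι)) :
    (1 - (prodBernoulli p).real {ω : Set ι | 0 ≤ (F.filter (· ∈ ω)).card}) *
            (prodBernoulli p).real {ω : Set ι | s ≤ (F.filter (· ∈ ω)).card} *
            ((prodBernoulli p).real ({ω : Set ι | 0 ≤ (F.filter (· ∈ ω)).card} ∩ A ∩ B)
              - (prodBernoulli p).real ({ω : Set ι | s ≤ (F.filter (· ∈ ω)).card} ∩ A ∩ B))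
        + (prodBernoulli p).real {ω : Set ι | s ≤ (F.filter (· ∈ ω)).card} *
            ((prodBernoulli p).real A - (prodBernoulli p).real ({ω : Set ι | 0 ≤ (F.filter (· ∈ ω)).card} ∩ A)) *
            ((prodBernoulli p).real B - (prodBernoulli p).real ({ω : Set ι | 0 ≤ (F.filter (· ∈ ω)).card} ∩ B))
        + (1 - (prodBernoulli p).real {ω : Set ι | 0 ≤ (F.filter (· ∈ ω)).card}) *
            (prodBernoulli p).real ({ω : Set ι | s ≤ (F.filter (· ∈ ω)).card} ∩ A) *
            (prodBernoulli p).real ({ω : Set ι | s ≤ (F.filter (· ∈ ω)).card} ∩ B)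
        - (1 - (prodBernoulli p).real {ω : Set ι | 0 ≤ (F.filter (· ∈ ω)).card}) *
            (prodBernoulli p).real {ω : Set ι | s ≤ (F.filter (· ∈ ω)).card} *
            (prodBernoulli p).real A * (prodBernoulli p).real B = 0 := by
  simp only [threshold_zero, Set.univ_inter, probReal_univ, sub_self, zero_mul, mul_zero, add_zero]


end SahiOneStep

end Summit.CriticalPhenomena.PercolationContinuityZ3.Theorems
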